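import Literature.RepresentationTheory.ModularTensorCategories.SU2LevelK

/-!
# Kauffman–Lins recoupling theory at `q = e^{iπ/r}`: θ-nets, the tetrahedron, the q-6j symbols,
# and the orthogonality and pentagon (Biedenharn–Elliott) identities AS PRINTED

Topic `Literature/RepresentationTheory/ModularTensorCategories` (definition item `defn-ModularDatum`; the
review of the `SU(2)_k` bundle prescribed: "file only the PRINTED identities as named facts, each with
its own locator and in the source's own normalisation (KL94 §7.3 Prop. 9 orthogonality and Prop. 10
Biedenharn–Elliott for the KL q-6j symbols) … and derive pentagon/unitarity of `fSym` by the
normalisation change"). Here `r = k + 2` and the quantum integers / factorials / q-admissibility are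
those of `SU2LevelK.lean` (`qInt`, `qFactorial`, `Adm`).

* `klDelta k n = Δ_n = (-1)^n [n+1]` (KL §9.4, §9.8); `thetaNet k a b c = θ(a,b,c)` (§9.10 (i));
  `tetNet k A B E C D F = Tet[A B E; C D F]` (§9.11, the closed formula); `sixjKL k a b i c d j` = the
  q-6j symbol `{a b i; c d j} = Tet[a b i; c d j] Δ_i / (θ(a,d,i) θ(b,c,i))` (§9.12), set to `0` unless
  its four triads `(a,d,i), (b,c,i), (a,b,j), (c,d,j)` are q-admissible ("sum over q-admissibles", §9.12).
* PROVED: `tetNet_eq` — the alternating sum of `Tet[a b f; c d e]` is literally `racahSum k a b e c d f`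
  of `SU2LevelK.lean` (same `aᵢ`, `bⱼ`), so `Tet = (𝓘!/𝓔!) · racahSum`; this is the bridge for the
  transport to the unitary F-symbols `fSym` (the normalisation change, found numerically to be
  `fSym a b c d e f = {a b f; c d e} · √(|Δ_e θ(b,c,f) θ(a,f,d)| / |Δ_f θ(a,b,e) θ(e,c,d)|)`, a gauge
  factor, is NOT proved here).
* NAMED FACTS (verbatim, two): `KLOrthogonality k` (§9.13 = §7.3 Prop. 9) and `KLPentagon k`
  (§9.14 = §7.3 Prop. 10). Both were checked numerically for `r = 3, 4, 5` on all label tuples with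
  these exact definitions (to `10⁻¹⁵`) in the filing unit — evidence for the transcription, not a proof.

Deliberately NOT here: proofs of the two facts (KL's proof is the Temperley–Lieb recoupling theorem,
Thm. 2 of §7.1, not available in Mathlib), the transport to `fSym`, hexagon/twist identities (§9.9, §9.15).
-/

noncomputable section

open Finset

namespace Literature.RepresentationTheory.ModularTensorCategories.SU2LevelK

variable (k : ℕ)

/-- Kauffman–Lins' loop value `Δ_n = (-1)^n [n+1]` of the `n`-th Jones–Wenzl projector
(`[n] = (-1)^{n-1} Δ_{n-1}`). [cite: KauffmanLins1994, §9.4 ([n] = (-1)^{n-1} Δ_{n-1}) and §9.8 (loop and projector)] -/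
def klDelta (n : ℕ) : ℝ := (-1 : ℝ) ^ n * qInt k (n + 1)

/-- The **θ-net** `θ(a,b,c) = (-1)^{m+n+p} [m+n+p+1]! [m]! [n]! [p]! / ([m+n]! [n+p]! [p+m]!)` with
`m = (a+b-c)/2`, `n = (b+c-a)/2`, `p = (a+c-b)/2` (symmetric in `m, n, p`; meaningful for admissible
`(a,b,c)`, junk `ℕ`-subtraction otherwise). [cite: KauffmanLins1994, §9.10 (i) (θ-net evaluation)] -/
def thetaNet (a b c : ℕ) : ℝ :=
  let m := (a + b - c) / 2
  let n := (b + c - a) / 2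
  let p := (a + c - b) / 2
  (-1 : ℝ) ^ (m + n + p) * qFactorial k (m + n + p + 1) * qFactorial k m * qFactorial k n *
    qFactorial k p / (qFactorial k (m + n) * qFactorial k (n + p) * qFactorial k (p + m))

/-- The **tetrahedral net** `Tet[A B E; C D F] = (𝓘!/𝓔!) Σ_{m ≤ s ≤ M} (-1)^s [s+1]! / (Πᵢ [s-aᵢ]! Πⱼ [bⱼ-s]!)`
with `a₁ = (A+D+E)/2, a₂ = (B+C+E)/2, a₃ = (A+B+F)/2, a₄ = (C+D+F)/2`, `b₁ = (B+D+E+F)/2,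
b₂ = (A+C+E+F)/2, b₃ = (A+B+C+D)/2`, `m = max aᵢ`, `M = min bⱼ`, `𝓘! = Π_{i,j} [bⱼ-aᵢ]!`,
`𝓔! = [A]![B]![C]![D]![E]![F]!`. [cite: KauffmanLins1994, §9.11 (Tetrahedral net) = §8.5 Prop. 12] -/
def tetNet (A B E C D F : ℕ) : ℝ :=
  let a₁ := (A + D + E) / 2
  let a₂ := (B + C + E) / 2
  let a₃ := (A + B + F) / 2
  let a₄ := (C + D + F) / 2
  let b₁ := (B + D + E + F) / 2
  let b₂ := (A + C + E + F) / 2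
  let b₃ := (A + B + C + D) / 2
  (qFactorial k (b₁ - a₁) * qFactorial k (b₁ - a₂) * qFactorial k (b₁ - a₃) * qFactorial k (b₁ - a₄) *
    (qFactorial k (b₂ - a₁) * qFactorial k (b₂ - a₂) * qFactorial k (b₂ - a₃) * qFactorial k (b₂ - a₄)) *
    (qFactorial k (b₃ - a₁) * qFactorial k (b₃ - a₂) * qFactorial k (b₃ - a₃) * qFactorial k (b₃ - a₄))) /
    (qFactorial k A * qFactorial k B * qFactorial k C * qFactorial k D * qFactorial k E * qFactorial k F) *
  ∑ s ∈ Icc (max (max a₁ a₂) (max a₃ a₄)) (min (min b₁ b₂) b₃),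
    (-1 : ℝ) ^ s * qFactorial k (s + 1) /
      (qFactorial k (s - a₁) * qFactorial k (s - a₂) * qFactorial k (s - a₃) * qFactorial k (s - a₄) *
        qFactorial k (b₁ - s) * qFactorial k (b₂ - s) * qFactorial k (b₃ - s))

/-- The **Kauffman–Lins q-6j symbol** `{a b i; c d j}_q = Tet[a b i; c d j] Δ_i / (θ(a,d,i) θ(b,c,i))`
at `q = e^{iπ/(k+2)}` (the recoupling coefficients of Thm. 2), set to `0` unless the four triads
`(a,d,i), (b,c,i), (a,b,j), (c,d,j)` are q-admissible. [cite: KauffmanLins1994, §9.12 (q-6j symbols; "sum over q-admissibles for q a 2r-th root of 1") and §7.1 Thm. 2] -/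
def sixjKL (a b i c d j : ℕ) : ℝ :=
  if Adm k a d i ∧ Adm k b c i ∧ Adm k a b j ∧ Adm k c d j then
    tetNet k a b i c d j * klDelta k i / (thetaNet k a d i * thetaNet k b c i)
  else 0

/-- The alternating sum inside `Tet[a b f; c d e]` is literally `racahSum k a b e c d f` of
`SU2LevelK.lean` (`a₃ = α₁, a₄ = α₂, a₂ = α₃, a₁ = α₄; b₃ = β₁, b₂ = β₂, b₁ = β₃`): the bridge to the
unitary F-symbols. [cite: KauffmanLins1994, §9.11] -/
theorem tetNet_eq (a b c d e f : ℕ) : tetNet k a b f c d e =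
    (qFactorial k ((b + d + f + e) / 2 - (a + d + f) / 2) * qFactorial k ((b + d + f + e) / 2 - (b + c + f) / 2) *
        qFactorial k ((b + d + f + e) / 2 - (a + b + e) / 2) * qFactorial k ((b + d + f + e) / 2 - (c + d + e) / 2) *
      (qFactorial k ((a + c + f + e) / 2 - (a + d + f) / 2) * qFactorial k ((a + c + f + e) / 2 - (b + c + f) / 2) *
        qFactorial k ((a + c + f + e) / 2 - (a + b + e) / 2) * qFactorial k ((a + c + f + e) / 2 - (c + d + e) / 2)) *
      (qFactorial k ((a + b + c + d) / 2 - (a + d + f) / 2) * qFactorial k ((a + b + c + d) / 2 - (b + c + f) / 2) *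
        qFactorial k ((a + b + c + d) / 2 - (a + b + e) / 2) * qFactorial k ((a + b + c + d) / 2 - (c + d + e) / 2))) /
    (qFactorial k a * qFactorial k b * qFactorial k c * qFactorial k d * qFactorial k f * qFactorial k e) *
    racahSum k a b e c d f := by
  unfold tetNet racahSum
  simp only
  congr 1
  · rw [show max (max ((a + d + f) / 2) ((b + c + f) / 2)) (max ((a + b + e) / 2) ((c + d + e) / 2)) =
        max (max ((a + b + e) / 2) ((e + c + d) / 2)) (max ((b + c + f) / 2) ((a + f + d) / 2)) by omega,
      show min (min ((b + d + f + e) / 2) ((a + c + f + e) / 2)) ((a + b + c + d) / 2) =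
        min (min ((a + b + c + d) / 2) ((a + e + c + f) / 2)) ((b + e + d + f) / 2) by omega]
    refine Finset.sum_congr rfl (fun s _ => ?_)
    rw [show (e + c + d) / 2 = (c + d + e) / 2 by omega, show (a + f + d) / 2 = (a + d + f) / 2 by omega,
      show (a + e + c + f) / 2 = (a + c + f + e) / 2 by omega, show (b + e + d + f) / 2 = (b + d + f + e) / 2 by omega]
    ring

/-- **Kauffman–Lins orthogonality identity** (named fact, as printed):
`Σ_i {a b i; c d j} {d a k'; b c i} = δ_{k'j}` at `q = e^{iπ/(k+2)}`, for q-admissible `(a,b,j)`,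
`(c,d,j)`, the sum running over the q-admissible `i` (here: all `i ≤ k`, inadmissible symbols being `0`).
[cite: KauffmanLins1994, §7.3 Prop. 9 (Orthogonality Identity) = §9.13] -/
def KLOrthogonality : Prop :=
  ∀ a b c d j k' : ℕ, a ≤ k → b ≤ k → c ≤ k → d ≤ k → k' ≤ k → Adm k a b j → Adm k c d j →
    ∑ i ∈ range (k + 1), sixjKL k a b i c d j * sixjKL k d a k' b c i = if k' = j then 1 else 0

/-- **Kauffman–Lins pentagon (Biedenharn–Elliott) identity** (named fact, as printed):
`Σ_m {a i m; d e j} {b c l; d m i} {b l k'; e a m} = {b c k'; j a i} {k' c l; d e j}` at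
`q = e^{iπ/(k+2)}` for all labels `≤ k` (inadmissible symbols `0`, sum over `m ≤ k`).
[cite: KauffmanLins1994, §7.3 Prop. 10 (Pentagon Identity, Biedenharn–Elliot) = §9.14] -/
def KLPentagon : Prop :=
  ∀ a b c d e i j k' l : ℕ, a ≤ k → b ≤ k → c ≤ k → d ≤ k → e ≤ k → i ≤ k → j ≤ k → k' ≤ k → l ≤ k →
    ∑ m ∈ range (k + 1), sixjKL k a i m d e j * sixjKL k b c l d m i * sixjKL k b l k' e a m =
      sixjKL k b c k' j a i * sixjKL k k' c l d e j

end Literature.RepresentationTheory.ModularTensorCategories.SU2LevelK
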